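import Literature.Probability.Percolation.LandedAltFourArm
import Literature.Probability.Percolation.NearCriticalFourArmQuasiMult
import HarnessLib

/-!
# Kesten's gluing lands in the ALTERNATING event: quasi-multiplicativity of `π̂^alt` from alternating separation

Topic `Literature/Probability/Percolation`; family `crit-perc`. PROOFS ONLY (no definition, no
named fact). Serves the discharge of `Literature.Probability.Percolation.Werner2009_lemma63`
(W. Werner, PCMI 2009, Lecture 6, Lemma 6.3) and `Werner2009_fourArm_quasiMult` (Cor. 6.2)
through Werner's alternating `π̂_p` (`altFourArmProbAt`, `AltFourArm.lean`).

The tree's deterministic gluing theorems (`sepFourArm_glue_subset`, `sepFourArm_glueExt_subset`,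
`ArmSeparationFourArm.lean`; Nolin 2008, Prop. 12 [arXiv 0711.4948: Prop. 11]; Kesten 1987) and the
gluing inequalities at every `t` (`sepFour_mul_sepFour_mul_glue_le_at`, `sepFour_mul_glueExt_le_at`,
`NearCriticalFourArmQuasiMult.lean`) record the glued arms as the ORDER-FREE event
`armEvent ![T,F,T,F]`, so that quasi-multiplicativity could so far be derived only for the
order-free `π̂` and only from ORDER-FREE separation (`Werner2009_fourArm_quasiMult_of_separation`),
whose left-hand side silently contains the adjacent arrangement. But the glued arms land on the
sides `0, 3` (open) and `1, 4` (closed) of the outer hexagon — they realise the LANDED event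
`landedAltFourArm` (`LandedAltFourArm.lean`), hence, by the Hex lemma
(`landedAltFourArm_subset_altFourArm`), the alternating event in cluster form. This file re-reads
the gluing with that conclusion and derives Werner's Cor. 6.2 for `π̂^alt` from ALTERNATING
separation alone (Nolin's Thm. 11 for `j = 4`, `σ = BWBW`, the hypothesis of
`ArmPatternsFourArm.lean` / `FourArmStabilityFromAltPattern.lean`), as in the literature, where
the whole calculus concerns one colour sequence:

* `PathIn.exists_landedArm` — trimming an open path that leaves `Λ_R` through the open cone over
  side `0` to an arm of `{r ≤ |·| ≤ R}` landed on side `0` (the exit step has norm `R + 1` in the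
  cone, so the last site inside lies on side `0`, `mem_hexSide_zero_of_adj_cone`);
* `sepArmAt_glue_path_landed`, `sepArmAt_glueExt_path_landed` — the glued / extended arm of colour
  `b` in frame `i` lands on side `i` (`sepOpenArmIn_glue_path` leaves `Λ_{n₃}` inside
  `sepConeSupport`, whose sites beyond `∂Λ_{n₃}` lie in the cone; the extended arm ends in
  `glueRegion q ⊆ triCone`);
* `sepFourArm_glue_subset_landedAlt`, `sepFourArm_glue_subset_altFourArm`,
  `sepFourArm_glueExt_subset_landedAlt`, `sepFourArm_glueExt_subset_altFourArm` — **gluing and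
  extension land in `landedAltFourArm ⊆ altFourArm`**;
* `sepFour_mul_sepFour_mul_glue_le_landed_at`, `sepFour_mul_glueExt_le_landed_at` (and the
  corollaries `…_alt_at`) — the gluing and extension inequalities at every `t` with
  `P_t(landedAltFourArm)`, resp. `π̂^alt_t`, on the right (proofs verbatim those of
  `NearCriticalFourArmQuasiMult.lean`, last step replaced);
* **`altFourArm_quasiMult_of_altSeparation`** — **Cor. 6.2 for `π̂^alt` below `L(p)` from
  alternating separation**: IF `c · π̂^alt_t(n, N) ≤ P_t(sepFourArm n N)` for `n₀ ≤ n`, `2n ≤ N`,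
  `N ≤ L(t, ε)` if `t > 1/2`, `t ∈ [1/2, 1/2 + δ)`, THEN
  `c' · π̂^alt_t(r, R) · π̂^alt_t(4R, S) ≤ π̂^alt_t(r, S)` for `r₁ ≤ r`, `16 r < 4R < S ≤ L(t, ε)`
  (proof verbatim that of `Werner2009_fourArm_quasiMult_of_separation`, the `∀∃` shape of
  `Werner2009_fourArm_quasiMult` with `altFourArmProbAt`). This is the quasi-multiplicativity
  hypothesis `hQ` of `Nolin2008_thm27_oneArm_of_altHyps` (`NearCriticalOneArmFromAltFacts.lean`) and,
  at `t = 1/2`, of `ArmExponentsFourArmAlt.lean`.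

## References

* P. Nolin, Near-critical percolation in two dimensions, *Electron. J. Probab.* 13 (2008)
  1562–1623, §4.2 (Def. 8), §4.3 (Thm. 11, Prop. 12, Lemma 13), §4.5 Prop. 17
  (arXiv 0711.4948: Def. 7, Thm. 10, Prop. 11, Lemma 12, Prop. 16) [Nolin2008].
* W. Werner, *Lectures on two-dimensional critical percolation*, IAS/Park City Math. Ser. 16
  (2009), Lecture 6, §4, Prop. 6.1 and Cor. 6.2 [WernerPCMI2009].
* H. Kesten, Scaling relations for 2D-percolation, *Comm. Math. Phys.* 109 (1987), Lemmas 4–6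
  [KestenScalingCMP1987].

Tree: `landedAltFourArm`, `mem_landedAltFourArm_of_pathIn`, `landedAltFourArm_subset_altFourArm`,
`hexSide`, `mem_hexSide_zero_of_adj_cone`, `image_rot_hexSide` (`LandedAltFourArm.lean`),
`sepOpenArmIn_glue_path`, `sepArmAt_glueExt_path`, `glueZone`, `image_rot_eq_glueZone`,
`glueZone_disjoint`, `mem_triCone_of_mem_glueRegion`, `mem_sepConeSupport`, `sepFourArm`,
`fourGlueFrames`, `fourGlueExtFrames` (`ArmSeparationFourArm.lean`), `pathIn_of_rotConfig_colour`
(`ArmEventsAPrioriPoly.lean`), everything used by `sepFour_mul_sepFour_mul_glue_le_at`,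
`sepFour_mul_glueExt_le_at`, `Werner2009_fourArm_quasiMult_of_separation`
(`NearCriticalFourArmQuasiMult.lean`), `altFourArmProbAt_anti`, `altFourArmProbAt_mono_left`,
`altFourArmProbAt_nonneg`, `altFourArmProbAt_le_one` (`AltFourArm.lean`).
-/

noncomputable section

open MeasureTheory Set
open scoped unitInterval

namespace Literature.Probability.Percolation

open LatticeModels

/-! ### Trimming a path that leaves through the cone to a landed arm -/

/-- **Trimming to a landed arm.** An open `𝕋`-path inside `Z ∩ ω` from a site of `Λ_r` to a site
outside `Λ_R` (`r ≤ R`), where the sites of `Z` beyond `∂Λ_R` lie in the open cone over side `0`,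
contains an open arm of `{r ≤ |·|_𝕋 ≤ R}` from `∂Λ_r` to SIDE `0` of `∂Λ_R`: the first step out of
`Λ_R` goes to a cone site of norm `R + 1`, so the site before it lies on side `0`
(`mem_hexSide_zero_of_adj_cone`); then cut at the last visit to `Λ_r` (as
`PathIn.exists_arm_of_triNorm_le`). [folklore] -/
theorem PathIn.exists_landedArm {Z ω : Set (Site 2)} {u v : Site 2} {r R : ℕ}
    (h : PathIn triGraph (Z ∩ ω) u v) (hu : triNorm u ≤ r) (hv : (R : ℤ) < triNorm v) (hrR : r ≤ R)
    (hZ : ∀ z ∈ Z, (R : ℤ) < triNorm z → (0 < z 0 ∧ z 1 < 0 ∧ 0 < z 0 + z 1)) :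
    ∃ x y : Site 2, triNorm x = r ∧ y ∈ hexSide R 0 ∧
      PathIn triGraph ({w : Site 2 | (r : ℤ) ≤ triNorm w ∧ triNorm w ≤ R} ∩ (Z ∩ ω)) x y := by
  have hrR' : (r : ℤ) ≤ R := by exact_mod_cast hrR
  -- first step out of `Λ_R`
  obtain ⟨a, b, ha, hb, hbA, hab, hua⟩ :=
    h.exit (R := {w : Site 2 | triNorm w ≤ R}) (show triNorm u ≤ R by omega)
      (fun hv' => absurd hv (not_lt.2 hv'))
  simp only [mem_setOf_eq, not_le] at ha hb
  have hb1 : triNorm b ≤ triNorm a + 1 := triNorm_le_triNorm_add_one_of_adj hab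
  have haR : triNorm a = R := by omega
  have hbR : triNorm b = (R : ℤ) + 1 := by omega
  have haSide : a ∈ hexSide R 0 := mem_hexSide_zero_of_adj_cone haR hbR (hZ b hbA.1 hb) hab
  -- last visit to `Λ_r`
  rcases hua.last_exit_or (C := {w : Site 2 | triNorm w ≤ r}) hu with har | ⟨a', b', ha', ha'A, hb', hab', hp⟩
  · simp only [mem_setOf_eq] at har
    have haA : a ∈ {w : Site 2 | (r : ℤ) ≤ triNorm w ∧ triNorm w ≤ R} ∩ (Z ∩ ω) :=
      ⟨⟨by omega, by omega⟩, hua.right_mem.2⟩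
    exact ⟨a, a, by omega, haSide, PathIn.refl haA⟩
  · simp only [mem_setOf_eq, not_le] at ha' hb'
    have ha'r : (r : ℤ) ≤ triNorm a' := by
      have := triNorm_le_triNorm_add_one_of_adj hab'
      omega
    have hbA' := hp.left_mem
    simp only [mem_sdiff, mem_inter_iff, mem_setOf_eq, not_le] at hbA'
    have haT : a' ∈ {w : Site 2 | (r : ℤ) ≤ triNorm w ∧ triNorm w ≤ R} ∩ (Z ∩ ω) :=
      ⟨⟨ha'r, ha'A.1⟩, ha'A.2⟩
    have hbT : b' ∈ {w : Site 2 | (r : ℤ) ≤ triNorm w ∧ triNorm w ≤ R} ∩ (Z ∩ ω) :=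
      ⟨⟨hbA'.2.le, hbA'.1.1⟩, hbA'.1.2⟩
    have hp' : PathIn triGraph ({w : Site 2 | (r : ℤ) ≤ triNorm w ∧ triNorm w ≤ R} ∩ (Z ∩ ω)) b' a := by
      refine hp.mono ?_
      rintro w ⟨⟨hw1, hw2⟩, hw3⟩
      simp only [mem_setOf_eq, not_le] at hw3
      exact ⟨⟨hw3.le, hw1⟩, hw2⟩
    exact ⟨a', a, le_antisymm ha' ha'r, haSide, (PathIn.of_adj haT hbT hab').trans hp'⟩

/-! ### The glued and the extended arm land on their side -/

/-- **The glued arm of colour `b` in frame `i` lands on side `i`.** As `sepArmAt_glue_path`, with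
the outer end on `hexSide n₃ i`: the open path of `sepOpenArmIn_glue_path` (frame `0`) leaves
`Λ_{n₃}` inside `sepConeSupport (512Q) n₃`, whose sites beyond `∂Λ_{n₃}` lie in the open cone
over side `0` (`mem_sepConeSupport`), so it is trimmed by `PathIn.exists_landedArm` and carried to
frame `i` by `ρ^i`. [cite: Nolin2008, §4.3 Prop. 12 (proof) (arXiv 0711.4948: Prop. 11)] -/
theorem sepArmAt_glue_path_landed {q n₁ n₃ i : ℕ} {b : Bool} (hq : 1 ≤ q) (h4 : 4 ≤ n₁)
    (h₁ : n₁ ≤ 64 * q) (h₃ : 512 * (q + 1) ≤ n₃) {X X' : Set (Site 2)} {ω : SiteConfig (Site 2)}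
    (hA : ω ∈ sepArmAt i b X n₁ (64 * q)) (hG : readFrame i b ω ∈ fourGlue q)
    (hA' : ω ∈ sepArmAt i b X' (512 * (q + 1)) n₃) :
    ∃ x y : Site 2, triNorm x = n₁ ∧ y ∈ hexSide n₃ i ∧
      PathIn triGraph (glueZone q n₁ n₃ i X X' ∩ triAnnSet n₁ n₃ ∩ {v | v ∈ ω ↔ b}) x y := by
  obtain ⟨u, u', hu, hu', P⟩ := sepOpenArmIn_glue_path hq h4 h₁ h₃ hA hG hA'
  set Z : Set (Site 2) := (triRotIsoPow i) ⁻¹' X ∩ sepConeSupport n₁ (64 * q) ∪ glueRegion q ∪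
    (triRotIsoPow i) ⁻¹' X' ∩ sepConeSupport (512 * (q + 1)) n₃ with hZ
  have h13 : n₁ ≤ n₃ := h₁.trans (le_trans (by omega) h₃)
  have e8 : 64 * q / 8 = 8 * q := by omega
  have E8 : 512 * (q + 1) / 8 = 64 * (q + 1) := by omega
  -- sites of the zone beyond `∂Λ_{n₃}` lie in the cone
  have hcone : ∀ z ∈ Z, (n₃ : ℤ) < triNorm z → (0 < z 0 ∧ z 1 < 0 ∧ 0 < z 0 + z 1) := by
    rintro z ((⟨-, hz⟩ | hz) | ⟨-, hz⟩) hn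
    · rw [mem_sepConeSupport, e8] at hz
      push_cast at hz
      omega
    · exact (mem_triCone_of_mem_glueRegion hz).1
    · rw [mem_sepConeSupport, E8] at hz
      exact hz.2.2 (Or.inr hn)
  have P' : PathIn triGraph (Z ∩ readFrame i b ω) u u' := P
  obtain ⟨x₀, y₀, hx₀, hy₀, Q⟩ := PathIn.exists_landedArm P' hu hu' h13 hcone
  -- back to frame `i`
  have Q' : PathIn triGraph (({w : Site 2 | (n₁ : ℤ) ≤ triNorm w ∧ triNorm w ≤ n₃} ∩ Z) ∩
      rotConfig i {v : Site 2 | v ∈ ω ↔ b}) x₀ y₀ :=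
    Q.mono fun w hw => ⟨⟨hw.1, hw.2.1⟩, hw.2.2⟩
  have Q'' := pathIn_of_rotConfig_colour i b Q'
  refine ⟨triRotIsoPow i x₀, triRotIsoPow i y₀, by rw [triNorm_rot, hx₀], ?_, Q''.mono ?_⟩
  · have : triRotIsoPow i y₀ ∈ triRotIsoPow i '' hexSide n₃ 0 := ⟨y₀, hy₀, rfl⟩
    rw [image_rot_hexSide, zero_add] at this
    exact this
  · rintro w ⟨⟨v, ⟨hvA, hvZ⟩, rfl⟩, hwc⟩
    refine ⟨⟨?_, ?_⟩, hwc⟩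
    · rw [← image_rot_eq_glueZone]
      exact ⟨v, hvZ, rfl⟩
    · rw [mem_triAnnSet, triNorm_rot]
      exact hvA

/-- **The extended arm of colour `b` in frame `i` lands on side `i`** of `∂Λ_{512Q - 1}`: its end
(`sepArmAt_glueExt_path`) has norm `512Q - 1 > 72q` and lies in the zone, hence in
`ρ^i(glueRegion q) ⊆ ρ^i(triCone)`, i.e. on side `i`. [cite: Nolin2008, §4.3 Prop. 12 (proof) (arXiv 0711.4948: Prop. 11)] -/
theorem sepArmAt_glueExt_path_landed {q n₁ i : ℕ} (n₃ : ℕ) {b : Bool} (hq : 1 ≤ q) (h4 : 4 ≤ n₁)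
    (h₁ : n₁ ≤ 64 * q) {X : Set (Site 2)} {ω : SiteConfig (Site 2)}
    (hA : ω ∈ sepArmAt i b X n₁ (64 * q)) (hG : readFrame i b ω ∈ fourGlueExt q) :
    ∃ x y : Site 2, triNorm x = n₁ ∧ y ∈ hexSide (512 * (q + 1) - 1) i ∧
      PathIn triGraph (glueZone q n₁ n₃ i X ∅ ∩ triAnnSet n₁ (512 * (q + 1) - 1) ∩ {v | v ∈ ω ↔ b}) x y := by
  obtain ⟨x, y, hx, hy, Q⟩ := sepArmAt_glueExt_path n₃ hq h4 h₁ hA hG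
  refine ⟨x, y, hx, ?_, Q⟩
  have hyZ := Q.right_mem.1.1
  have e8 : 64 * q / 8 = 8 * q := by omega
  have hc : ((512 * (q + 1) - 1 : ℕ) : ℤ) = 512 * ((q : ℤ) + 1) - 1 := by
    push_cast [Nat.cast_sub (by omega : 1 ≤ 512 * (q + 1))]; ring
  rw [hc] at hy
  rcases hyZ with (⟨-, ⟨s, hs, hsy⟩⟩ | ⟨g, hg, hgy⟩) | ⟨hyE, -⟩
  · -- the inner support does not reach norm `512Q - 1`
    exfalso
    rw [mem_sepConeSupport, e8] at hs
    have hn : triNorm y = triNorm s := by rw [← hsy, triNorm_rot]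
    push_cast at hs
    omega
  · obtain ⟨hcg, -, -⟩ := mem_triCone_of_mem_glueRegion hg
    have hn : triNorm g = triNorm y := by rw [← hgy, triNorm_rot]
    have hg0 : g 0 = 512 * ((q : ℤ) + 1) - 1 := by
      rw [← hy, ← hn, triNorm_eq_apply_zero hcg.2.1.le hcg.2.2.le]
    refine mem_hexSide_iff.2 ⟨g, ⟨?_, ?_, hcg.2.1.le⟩, hgy⟩
    · rw [hg0, hc]
    · rw [hc]; omega
  · exact absurd hyE (Set.notMem_empty _)

/-! ### Gluing and extension land in `landedAltFourArm ⊆ altFourArm` -/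

/-- **Gluing four well-separated arms lands in the landed alternating event** (Nolin 2008, proof of
Prop. 12 (ii) [arXiv 0711.4948: Prop. 11], `j = 4`, `σ = BWBW`): as `sepFourArm_glue_subset`, with
`landedAltFourArm n₁ n₃` on the right (each glued arm lands on its side,
`sepArmAt_glue_path_landed`; the four zones are pairwise disjoint, `glueZone_disjoint`). [cite: Nolin2008, §4.3 Prop. 12 (arXiv 0711.4948: Prop. 11)] -/
theorem sepFourArm_glue_subset_landedAlt {q n₁ n₃ : ℕ} (hq : 1 ≤ q) (h4 : 4 ≤ n₁) (h₁ : n₁ ≤ 64 * q)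
    (h₃ : 512 * (q + 1) ≤ n₃) :
    sepFourArm n₁ (64 * q) ∩ fourGlueFrames q ∩ sepFourArm (512 * (q + 1)) n₃ ⊆
      landedAltFourArm n₁ n₃ := by
  rintro ω ⟨⟨⟨⟨X₀, X₃, hX03, hA₀, hA₃⟩, ⟨X₁, X₄, hX14, hA₁, hA₄⟩⟩, ⟨hG₀, hG₃⟩, hG₁, hG₄⟩,
    ⟨Y₀, Y₃, hY03, hB₀, hB₃⟩, ⟨Y₁, Y₄, hY14, hB₁, hB₄⟩⟩
  have P₀ := sepArmAt_glue_path_landed hq h4 h₁ h₃ hA₀ hG₀ hB₀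
  have P₃ := sepArmAt_glue_path_landed hq h4 h₁ h₃ hA₃ hG₃ hB₃
  have P₁ := sepArmAt_glue_path_landed hq h4 h₁ h₃ hA₁ hG₁ hB₁
  have P₄ := sepArmAt_glue_path_landed hq h4 h₁ h₃ hA₄ hG₄ hB₄
  set T : Fin 4 → Set (Site 2) :=
    ![glueZone q n₁ n₃ 0 X₀ Y₀ ∩ triAnnSet n₁ n₃ ∩ {v | v ∈ ω ↔ true},
      glueZone q n₁ n₃ 1 X₁ Y₁ ∩ triAnnSet n₁ n₃ ∩ {v | v ∈ ω ↔ false},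
      glueZone q n₁ n₃ 3 X₃ Y₃ ∩ triAnnSet n₁ n₃ ∩ {v | v ∈ ω ↔ true},
      glueZone q n₁ n₃ 4 X₄ Y₄ ∩ triAnnSet n₁ n₃ ∩ {v | v ∈ ω ↔ false}] with hT
  have d03 : Disjoint (T 0) (T 2) :=
    Disjoint.mono (inter_subset_left.trans inter_subset_left) (inter_subset_left.trans inter_subset_left)
      (glueZone_disjoint hq (by norm_num) (by norm_num) (by norm_num) hX03 hY03)
  have d14 : Disjoint (T 1) (T 3) :=
    Disjoint.mono (inter_subset_left.trans inter_subset_left) (inter_subset_left.trans inter_subset_left)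
      (glueZone_disjoint hq (by norm_num) (by norm_num) (by norm_num) hX14 hY14)
  refine mem_landedAltFourArm_of_pathIn T ?_ ?_ ?_ ?_
  · intro i j hij
    fin_cases i <;> fin_cases j
    all_goals first
      | exact absurd rfl hij
      | exact d03 | exact d03.symm | exact d14 | exact d14.symm
      | exact disjoint_inter_colour (by decide)
  · intro i z hz
    fin_cases i <;> simpa [hT] using hz.2
  · intro i z hz
    fin_cases i <;> exact (mem_triAnnSet.1 (by simpa [hT] using hz.1.2))
  · intro i
    fin_cases i
    · obtain ⟨x, y, hx, hy, Q⟩ := P₀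
      exact ⟨x, mem_triSphere_iff.2 hx, y, hy, Q⟩
    · obtain ⟨x, y, hx, hy, Q⟩ := P₁
      exact ⟨x, mem_triSphere_iff.2 hx, y, hy, Q⟩
    · obtain ⟨x, y, hx, hy, Q⟩ := P₃
      exact ⟨x, mem_triSphere_iff.2 hx, y, hy, Q⟩
    · obtain ⟨x, y, hx, hy, Q⟩ := P₄
      exact ⟨x, mem_triSphere_iff.2 hx, y, hy, Q⟩

/-- **Gluing lands in the alternating event (cluster form)**: `sepFourArm n₁ (64q) ∩ fourGlueFrames q ∩
sepFourArm (512(q+1)) n₃ ⊆ altFourArm n₁ n₃` (`sepFourArm_glue_subset_landedAlt` with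
`landedAltFourArm_subset_altFourArm`). [cite: Nolin2008, §4.3 Prop. 12 (arXiv 0711.4948: Prop. 11)] [cite: WernerPCMI2009, Lecture 6, Prop. 6.1] -/
theorem sepFourArm_glue_subset_altFourArm {q n₁ n₃ : ℕ} (hq : 1 ≤ q) (h4 : 4 ≤ n₁) (h₁ : n₁ ≤ 64 * q)
    (h₃ : 512 * (q + 1) ≤ n₃) :
    sepFourArm n₁ (64 * q) ∩ fourGlueFrames q ∩ sepFourArm (512 * (q + 1)) n₃ ⊆ altFourArm n₁ n₃ :=
  (sepFourArm_glue_subset_landedAlt hq h4 h₁ h₃).trans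
    (landedAltFourArm_subset_altFourArm (by omega) (h₁.trans (le_trans (by omega) h₃)))

/-- **Extending four well-separated arms lands in the landed alternating event** (Nolin 2008,
Prop. 12 (i) [arXiv 0711.4948: Prop. 11]): as `sepFourArm_glueExt_subset`, with
`landedAltFourArm n₁ (512(q+1) - 1)` on the right. [cite: Nolin2008, §4.3 Prop. 12 (arXiv 0711.4948: Prop. 11)] -/
theorem sepFourArm_glueExt_subset_landedAlt {q n₁ : ℕ} (hq : 1 ≤ q) (h4 : 4 ≤ n₁) (h₁ : n₁ ≤ 64 * q) :
    sepFourArm n₁ (64 * q) ∩ fourGlueExtFrames q ⊆ landedAltFourArm n₁ (512 * (q + 1) - 1) := by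
  rintro ω ⟨⟨⟨X₀, X₃, hX03, hA₀, hA₃⟩, ⟨X₁, X₄, hX14, hA₁, hA₄⟩⟩, ⟨hG₀, hG₃⟩, hG₁, hG₄⟩
  set n₃ := 512 * (q + 1) with hn₃
  set N := 512 * (q + 1) - 1 with hN
  have P₀ := sepArmAt_glueExt_path_landed n₃ hq h4 h₁ hA₀ hG₀
  have P₃ := sepArmAt_glueExt_path_landed n₃ hq h4 h₁ hA₃ hG₃
  have P₁ := sepArmAt_glueExt_path_landed n₃ hq h4 h₁ hA₁ hG₁
  have P₄ := sepArmAt_glueExt_path_landed n₃ hq h4 h₁ hA₄ hG₄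
  set T : Fin 4 → Set (Site 2) :=
    ![glueZone q n₁ n₃ 0 X₀ ∅ ∩ triAnnSet n₁ N ∩ {v | v ∈ ω ↔ true},
      glueZone q n₁ n₃ 1 X₁ ∅ ∩ triAnnSet n₁ N ∩ {v | v ∈ ω ↔ false},
      glueZone q n₁ n₃ 3 X₃ ∅ ∩ triAnnSet n₁ N ∩ {v | v ∈ ω ↔ true},
      glueZone q n₁ n₃ 4 X₄ ∅ ∩ triAnnSet n₁ N ∩ {v | v ∈ ω ↔ false}] with hT
  have hE : Disjoint (∅ : Set (Site 2)) ∅ := disjoint_bot_left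
  have d03 : Disjoint (T 0) (T 2) :=
    Disjoint.mono (inter_subset_left.trans inter_subset_left) (inter_subset_left.trans inter_subset_left)
      (glueZone_disjoint hq (by norm_num) (by norm_num) (by norm_num) hX03 hE)
  have d14 : Disjoint (T 1) (T 3) :=
    Disjoint.mono (inter_subset_left.trans inter_subset_left) (inter_subset_left.trans inter_subset_left)
      (glueZone_disjoint hq (by norm_num) (by norm_num) (by norm_num) hX14 hE)
  refine mem_landedAltFourArm_of_pathIn T ?_ ?_ ?_ ?_
  · intro i j hij
    fin_cases i <;> fin_cases j
    all_goals first
      | exact absurd rfl hij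
      | exact d03 | exact d03.symm | exact d14 | exact d14.symm
      | exact disjoint_inter_colour (by decide)
  · intro i z hz
    fin_cases i <;> simpa [hT] using hz.2
  · intro i z hz
    fin_cases i <;> exact (mem_triAnnSet.1 (by simpa [hT] using hz.1.2))
  · intro i
    fin_cases i
    · obtain ⟨x, y, hx, hy, Q⟩ := P₀
      exact ⟨x, mem_triSphere_iff.2 hx, y, hy, Q⟩
    · obtain ⟨x, y, hx, hy, Q⟩ := P₁
      exact ⟨x, mem_triSphere_iff.2 hx, y, hy, Q⟩
    · obtain ⟨x, y, hx, hy, Q⟩ := P₃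
      exact ⟨x, mem_triSphere_iff.2 hx, y, hy, Q⟩
    · obtain ⟨x, y, hx, hy, Q⟩ := P₄
      exact ⟨x, mem_triSphere_iff.2 hx, y, hy, Q⟩

/-- **Extension lands in the alternating event (cluster form)**:
`sepFourArm n₁ (64q) ∩ fourGlueExtFrames q ⊆ altFourArm n₁ (512(q+1) - 1)`. [cite: Nolin2008, §4.3 Prop. 12 (arXiv 0711.4948: Prop. 11)] -/
theorem sepFourArm_glueExt_subset_altFourArm {q n₁ : ℕ} (hq : 1 ≤ q) (h4 : 4 ≤ n₁) (h₁ : n₁ ≤ 64 * q) :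
    sepFourArm n₁ (64 * q) ∩ fourGlueExtFrames q ⊆ altFourArm n₁ (512 * (q + 1) - 1) :=
  (sepFourArm_glueExt_subset_landedAlt hq h4 h₁).trans
    (landedAltFourArm_subset_altFourArm (by omega) (by omega))

/-! ### The gluing inequalities at every `t`, alternating conclusion -/

set_option maxHeartbeats 1600000 in
set_option maxRecDepth 4096 in
/-- **The gluing inequality for four arms at every `t`, landing in the LANDED event** (Nolin 2008,
Prop. 12 and Lemma 13 [arXiv 0711.4948: Prop. 11, Lemma 12]):
`P_t(sep₄(n₁, 64q)) · P_t(sep₄(512(q+1), n₃)) · P_t(G)² · P_{1-t}(G)² ≤ P_t(landedAltFourArm n₁ n₃)`.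
Proof verbatim that of `sepFour_mul_sepFour_mul_glue_le_at` (`NearCriticalFourArmQuasiMult.lean`),
with `sepFourArm_glue_subset_landedAlt` in the last step. [cite: Nolin2008, §4.3 Prop. 12 and Lemma 13 (arXiv 0711.4948: Prop. 11, Lemma 12)] -/
theorem sepFour_mul_sepFour_mul_glue_le_landed_at (t : unitInterval) {q n₁ n₃ : ℕ} (hq : 1 ≤ q) (h4 : 4 ≤ n₁)
    (h₁ : n₁ ≤ 64 * q) (h₃ : 512 * (q + 1) ≤ n₃) :
    (triSitePercolation t).real (sepFourArm n₁ (64 * q)) *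
        (triSitePercolation t).real (sepFourArm (512 * (q + 1)) n₃) *
        ((triSitePercolation t).real (fourGlue q) ^ 2 * (triSitePercolation (σ t)).real (fourGlue q) ^ 2) ≤
      (triSitePercolation t).real (landedAltFourArm n₁ n₃) := by
  classical
  -- the three pairwise disjoint regions of Nolin's Lemma 13
  set S : Finset (Site 2) := triBall (64 * q) ∪
    (triBall (n₃ + n₃ / 8)).filter (fun v => 512 * ((q : ℤ) + 1) ≤ triNorm v) with hS
  set P : Finset (Site 2) := (triBall (512 * (q + 1))).filter
    (fun v => (64 * q : ℤ) < triNorm v ∧ triNorm v < 512 * ((q : ℤ) + 1) ∧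
      ((0 < v 0 ∧ v 1 < 0 ∧ 0 < v 0 + v 1) ∨ (v 0 < 0 ∧ 0 < v 1 ∧ v 0 + v 1 < 0))) with hP
  set M : Finset (Site 2) := (triBall (512 * (q + 1))).filter
    (fun v => (64 * q : ℤ) < triNorm v ∧ triNorm v < 512 * ((q : ℤ) + 1) ∧
      ((0 < v 0 ∧ 0 < v 1) ∨ (v 0 < 0 ∧ v 1 < 0))) with hM
  have hSP : Disjoint S P := by
    rw [Finset.disjoint_left]; intro v hvS hvP
    simp only [hS, hP, Finset.mem_union, Finset.mem_filter, mem_triBall_iff] at hvS hvP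
    push_cast at hvS hvP; omega
  have hSM : Disjoint S M := by
    rw [Finset.disjoint_left]; intro v hvS hvM
    simp only [hS, hM, Finset.mem_union, Finset.mem_filter, mem_triBall_iff] at hvS hvM
    push_cast at hvS hvM; omega
  have hPM : Disjoint P M := by
    rw [Finset.disjoint_left]; intro v hvP hvM
    simp only [hP, hM, Finset.mem_filter] at hvP hvM
    omega
  have e8 : 64 * q / 8 = 8 * q := by omega
  have E8 : 512 * (q + 1) / 8 = 64 * (q + 1) := by omega
  have hq' : (1 : ℤ) ≤ q := by exact_mod_cast hq
  have h₃' : (512 : ℤ) * (q + 1) ≤ n₃ := by exact_mod_cast h₃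
  -- supports of the arm events: inner scale
  have hIn0 : triRotIsoPow 0 '' sepConeSupport n₁ (64 * q) ⊆ ↑S ∪ ↑P := by
    rintro w ⟨v, hv, rfl⟩
    rw [mem_sepConeSupport, e8] at hv
    simp only [triRotIsoPow_zero_apply, Set.mem_union, Finset.mem_coe, hS, hP, Finset.mem_union,
      Finset.mem_filter, mem_triBall_iff]
    push_cast at hv ⊢; omega
  have hIn3 : triRotIsoPow 3 '' sepConeSupport n₁ (64 * q) ⊆ ↑S ∪ ↑P := by
    rintro w ⟨v, hv, rfl⟩
    rw [mem_sepConeSupport, e8] at hv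
    obtain ⟨-, -, -, -, -, -, r30, r31, -⟩ := rot_apply_formula v
    have hn := triNorm_rot 3 v
    simp only [Set.mem_union, Finset.mem_coe, hS, hP, Finset.mem_union, Finset.mem_filter, mem_triBall_iff,
      r30, r31, hn]
    push_cast at hv ⊢; omega
  have hIn1 : triRotIsoPow 1 '' sepConeSupport n₁ (64 * q) ⊆ ↑S ∪ ↑M := by
    rintro w ⟨v, hv, rfl⟩
    rw [mem_sepConeSupport, e8] at hv
    obtain ⟨-, -, r10, r11, -⟩ := rot_apply_formula v
    have hn := triNorm_rot 1 v
    simp only [Set.mem_union, Finset.mem_coe, hS, hM, Finset.mem_union, Finset.mem_filter, mem_triBall_iff,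
      r10, r11, hn]
    push_cast at hv ⊢; omega
  have hIn4 : triRotIsoPow 4 '' sepConeSupport n₁ (64 * q) ⊆ ↑S ∪ ↑M := by
    rintro w ⟨v, hv, rfl⟩
    rw [mem_sepConeSupport, e8] at hv
    obtain ⟨-, -, -, -, -, -, -, -, r40, r41, -⟩ := rot_apply_formula v
    have hn := triNorm_rot 4 v
    simp only [Set.mem_union, Finset.mem_coe, hS, hM, Finset.mem_union, Finset.mem_filter, mem_triBall_iff,
      r40, r41, hn]
    push_cast at hv ⊢; omega
  -- supports of the arm events: outer scale
  have hOut0 : triRotIsoPow 0 '' sepConeSupport (512 * (q + 1)) n₃ ⊆ ↑S ∪ ↑P := by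
    rintro w ⟨v, hv, rfl⟩
    rw [mem_sepConeSupport, E8] at hv
    simp only [triRotIsoPow_zero_apply, Set.mem_union, Finset.mem_coe, hS, hP, Finset.mem_union,
      Finset.mem_filter, mem_triBall_iff]
    push_cast at hv ⊢; omega
  have hOut3 : triRotIsoPow 3 '' sepConeSupport (512 * (q + 1)) n₃ ⊆ ↑S ∪ ↑P := by
    rintro w ⟨v, hv, rfl⟩
    rw [mem_sepConeSupport, E8] at hv
    obtain ⟨-, -, -, -, -, -, r30, r31, -⟩ := rot_apply_formula v
    have hn := triNorm_rot 3 v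
    simp only [Set.mem_union, Finset.mem_coe, hS, hP, Finset.mem_union, Finset.mem_filter, mem_triBall_iff,
      r30, r31, hn]
    push_cast at hv ⊢; omega
  have hOut1 : triRotIsoPow 1 '' sepConeSupport (512 * (q + 1)) n₃ ⊆ ↑S ∪ ↑M := by
    rintro w ⟨v, hv, rfl⟩
    rw [mem_sepConeSupport, E8] at hv
    obtain ⟨-, -, r10, r11, -⟩ := rot_apply_formula v
    have hn := triNorm_rot 1 v
    simp only [Set.mem_union, Finset.mem_coe, hS, hM, Finset.mem_union, Finset.mem_filter, mem_triBall_iff,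
      r10, r11, hn]
    push_cast at hv ⊢; omega
  have hOut4 : triRotIsoPow 4 '' sepConeSupport (512 * (q + 1)) n₃ ⊆ ↑S ∪ ↑M := by
    rintro w ⟨v, hv, rfl⟩
    rw [mem_sepConeSupport, E8] at hv
    obtain ⟨-, -, -, -, -, -, -, -, r40, r41, -⟩ := rot_apply_formula v
    have hn := triNorm_rot 4 v
    simp only [Set.mem_union, Finset.mem_coe, hS, hM, Finset.mem_union, Finset.mem_filter, mem_triBall_iff,
      r40, r41, hn]
    push_cast at hv ⊢; omega
  -- supports of the gluing events
  have hGF : ∀ v ∈ fourGlueFinset q, 0 < v 0 ∧ v 1 < 0 ∧ 0 < v 0 + v 1 := by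
    intro v hv
    have h := fourGlueFinset_subset hq hv
    exact ⟨by omega, h.2.2.1, h.2.2.2⟩
  have hG0 : triRotIsoPow 0 '' (↑(fourGlueFinset q) : Set (Site 2)) ⊆ ↑P := by
    rintro w ⟨v, hv, rfl⟩
    have h := fourGlueFinset_subset hq (Finset.mem_coe.1 hv)
    have hn : triNorm v = v 0 := triNorm_eq_apply_zero h.2.2.1.le h.2.2.2.le
    simp only [triRotIsoPow_zero_apply, Finset.mem_coe, hP, Finset.mem_filter, mem_triBall_iff, hn]
    push_cast; omega
  have hG3 : triRotIsoPow 3 '' (↑(fourGlueFinset q) : Set (Site 2)) ⊆ ↑P := by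
    rintro w ⟨v, hv, rfl⟩
    have h := fourGlueFinset_subset hq (Finset.mem_coe.1 hv)
    have hn : triNorm (triRotIsoPow 3 v) = v 0 := by
      rw [triNorm_rot]; exact triNorm_eq_apply_zero h.2.2.1.le h.2.2.2.le
    obtain ⟨-, -, -, -, -, -, r30, r31, -⟩ := rot_apply_formula v
    simp only [Finset.mem_coe, hP, Finset.mem_filter, mem_triBall_iff, hn, r30, r31]
    push_cast; omega
  have hG1 : triRotIsoPow 1 '' (↑(fourGlueFinset q) : Set (Site 2)) ⊆ ↑M := by
    rintro w ⟨v, hv, rfl⟩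
    have h := fourGlueFinset_subset hq (Finset.mem_coe.1 hv)
    have hn : triNorm (triRotIsoPow 1 v) = v 0 := by
      rw [triNorm_rot]; exact triNorm_eq_apply_zero h.2.2.1.le h.2.2.2.le
    obtain ⟨-, -, r10, r11, -⟩ := rot_apply_formula v
    simp only [Finset.mem_coe, hM, Finset.mem_filter, mem_triBall_iff, hn, r10, r11]
    push_cast; omega
  have hG4 : triRotIsoPow 4 '' (↑(fourGlueFinset q) : Set (Site 2)) ⊆ ↑M := by
    rintro w ⟨v, hv, rfl⟩
    have h := fourGlueFinset_subset hq (Finset.mem_coe.1 hv)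
    have hn : triNorm (triRotIsoPow 4 v) = v 0 := by
      rw [triNorm_rot]; exact triNorm_eq_apply_zero h.2.2.1.le h.2.2.2.le
    obtain ⟨-, -, -, -, -, -, -, -, r40, r41, -⟩ := rot_apply_formula v
    simp only [Finset.mem_coe, hM, Finset.mem_filter, mem_triBall_iff, hn, r40, r41]
    push_cast; omega
  -- locality of the events
  have h4' : 4 ≤ 512 * (q + 1) := by omega
  have dA₁ := determinedBy_sepArmPair 0 true h4 h₁
  have dA₂ := determinedBy_sepArmPair 0 true h4' h₃
  have dC₁ := determinedBy_sepArmPair 1 false h4 h₁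
  have dC₂ := determinedBy_sepArmPair 1 false h4' h₃
  have dG := determinedBy_fourGlue q
  -- the events
  set A₁ := sepArmPair 0 true n₁ (64 * q) with hA₁
  set A₂ := sepArmPair 0 true (512 * (q + 1)) n₃ with hA₂
  set C₁ := sepArmPair 1 false n₁ (64 * q) with hC₁
  set C₂ := sepArmPair 1 false (512 * (q + 1)) n₃ with hC₂
  set G := fourGlue q with hGdef
  -- Nolin's Lemma 13
  have fkg := triSitePercolation_locallyMonotone_fkg t hSP hSM hPM
    (Ap := A₁ ∩ A₂) (Am := C₁ ∩ C₂)
    (Bp := readFrame 0 true ⁻¹' G ∩ readFrame 3 true ⁻¹' G)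
    (Bm := readFrame 1 false ⁻¹' G ∩ readFrame 4 false ⁻¹' G)
    ((isUpperSet_sepArmPair_true 0 n₁ (64 * q)).inter (isUpperSet_sepArmPair_true 0 (512 * (q + 1)) n₃))
    ((isLowerSet_sepArmPair_false 1 n₁ (64 * q)).inter (isLowerSet_sepArmPair_false 1 (512 * (q + 1)) n₃))
    ((IsUpperSet.preimage_readFrame_true 0 (isUpperSet_fourGlue q)).inter
      (IsUpperSet.preimage_readFrame_true 3 (isUpperSet_fourGlue q)))
    ((IsUpperSet.preimage_readFrame_false 1 (isUpperSet_fourGlue q)).inter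
      (IsUpperSet.preimage_readFrame_false 4 (isUpperSet_fourGlue q)))
    ((dA₁.mono (union_subset hIn0 hIn3)).inter (dA₂.mono (union_subset hOut0 hOut3)))
    ((dC₁.mono (union_subset hIn1 hIn4)).inter (dC₂.mono (union_subset hOut1 hOut4)))
    (((determinedBy_preimage_readFrame 0 true dG).mono hG0).inter
      ((determinedBy_preimage_readFrame 3 true dG).mono hG3))
    (((determinedBy_preimage_readFrame 1 false dG).mono hG1).inter
      ((determinedBy_preimage_readFrame 4 false dG).mono hG4))
  have hAA : A₁ ∩ A₂ ∩ (C₁ ∩ C₂) = sepFourArm n₁ (64 * q) ∩ sepFourArm (512 * (q + 1)) n₃ :=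
    Set.inter_inter_inter_comm _ _ _ _
  -- independence of the two well-separated events
  have dS₁ : DeterminedBy (sepFourArm n₁ (64 * q)) ↑(triBall (72 * q)) :=
    (dA₁.mono (union_subset (image_rot_sepConeSupport_inner_subset 0)
      (image_rot_sepConeSupport_inner_subset (0 + 3)))).inter
    (dC₁.mono (union_subset (image_rot_sepConeSupport_inner_subset 1)
      (image_rot_sepConeSupport_inner_subset (1 + 3))))
  have dS₂ : DeterminedBy (sepFourArm (512 * (q + 1)) n₃)
      ↑((triBall (n₃ + n₃ / 8)).filter (fun v => 448 * ((q : ℤ) + 1) ≤ triNorm v)) :=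
    (dA₂.mono (union_subset (image_rot_sepConeSupport_outer_subset 0)
      (image_rot_sepConeSupport_outer_subset (0 + 3)))).inter
    (dC₂.mono (union_subset (image_rot_sepConeSupport_outer_subset 1)
      (image_rot_sepConeSupport_outer_subset (1 + 3))))
  have hdisj : Disjoint (triBall (72 * q))
      ((triBall (n₃ + n₃ / 8)).filter (fun v => 448 * ((q : ℤ) + 1) ≤ triNorm v)) := by
    rw [Finset.disjoint_left]; intro v hv hv'
    simp only [Finset.mem_filter, mem_triBall_iff] at hv hv'
    push_cast at hv hv'; omega
  have hind : (triSitePercolation t).real (sepFourArm n₁ (64 * q) ∩ sepFourArm (512 * (q + 1)) n₃) =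
      (triSitePercolation t).real (sepFourArm n₁ (64 * q)) *
        (triSitePercolation t).real (sepFourArm (512 * (q + 1)) n₃) :=
    sitePercolation_real_inter_of_disjoint t dS₁ dS₂ hdisj
  -- independence of the tubes of different frames
  have hBp : (triSitePercolation t).real (readFrame 0 true ⁻¹' G ∩ readFrame 3 true ⁻¹' G) =
      (triSitePercolation t).real G * (triSitePercolation t).real G := by
    rw [real_inter_preimage_readFrame_at t (by norm_num) (by norm_num) (by norm_num) true dG hGF]; rfl
  have hBm : (triSitePercolation t).real (readFrame 1 false ⁻¹' G ∩ readFrame 4 false ⁻¹' G) =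
      (triSitePercolation (σ t)).real G * (triSitePercolation (σ t)).real G := by
    rw [real_inter_preimage_readFrame_at t (by norm_num) (by norm_num) (by norm_num) false dG hGF]; rfl
  -- the deterministic gluing
  have hsub : A₁ ∩ A₂ ∩ (C₁ ∩ C₂) ∩
      (readFrame 0 true ⁻¹' G ∩ readFrame 3 true ⁻¹' G ∩ (readFrame 1 false ⁻¹' G ∩ readFrame 4 false ⁻¹' G)) ⊆
      landedAltFourArm n₁ n₃ := by
    rintro ω ⟨⟨⟨hA1, hA2⟩, hC1, hC2⟩, hBp', hBm'⟩
    exact sepFourArm_glue_subset_landedAlt hq h4 h₁ h₃ ⟨⟨⟨hA1, hC1⟩, hBp', hBm'⟩, hA2, hC2⟩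
  calc (triSitePercolation t).real (sepFourArm n₁ (64 * q)) *
        (triSitePercolation t).real (sepFourArm (512 * (q + 1)) n₃) *
        ((triSitePercolation t).real G ^ 2 * (triSitePercolation (σ t)).real G ^ 2)
      = (triSitePercolation t).real (A₁ ∩ A₂ ∩ (C₁ ∩ C₂)) *
          ((triSitePercolation t).real (readFrame 0 true ⁻¹' G ∩ readFrame 3 true ⁻¹' G) *
            (triSitePercolation t).real (readFrame 1 false ⁻¹' G ∩ readFrame 4 false ⁻¹' G)) := by
        rw [hAA, hind, hBp, hBm]; ring
    _ ≤ _ := fkg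
    _ ≤ (triSitePercolation t).real (landedAltFourArm n₁ n₃) := measureReal_mono hsub (measure_ne_top _ _)

set_option maxHeartbeats 1600000 in
set_option maxRecDepth 4096 in
/-- **The extension inequality for four arms at every `t`, landing in the LANDED event** (Nolin
2008, Prop. 12 (i) [arXiv 0711.4948: Prop. 11]):
`P_t(sep₄(n₁, 64q)) · P_t(G_ext)² · P_{1-t}(G_ext)² ≤ P_t(landedAltFourArm n₁ (512(q+1) - 1))`; proof
verbatim that of `sepFour_mul_glueExt_le_at`, last step `sepFourArm_glueExt_subset_landedAlt`. [cite: Nolin2008, §4.3 Prop. 12 and Lemma 13 (arXiv 0711.4948: Prop. 11, Lemma 12)] -/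
theorem sepFour_mul_glueExt_le_landed_at (t : unitInterval) {q n₁ : ℕ} (hq : 1 ≤ q) (h4 : 4 ≤ n₁) (h₁ : n₁ ≤ 64 * q) :
    (triSitePercolation t).real (sepFourArm n₁ (64 * q)) *
        ((triSitePercolation t).real (fourGlueExt q) ^ 2 * (triSitePercolation (σ t)).real (fourGlueExt q) ^ 2) ≤
      (triSitePercolation t).real (landedAltFourArm n₁ (512 * (q + 1) - 1)) := by
  classical
  set S : Finset (Site 2) := triBall (64 * q) with hS
  set P : Finset (Site 2) := (triBall (512 * (q + 1))).filter
    (fun v => (64 * q : ℤ) < triNorm v ∧ triNorm v < 512 * ((q : ℤ) + 1) ∧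
      ((0 < v 0 ∧ v 1 < 0 ∧ 0 < v 0 + v 1) ∨ (v 0 < 0 ∧ 0 < v 1 ∧ v 0 + v 1 < 0))) with hP
  set M : Finset (Site 2) := (triBall (512 * (q + 1))).filter
    (fun v => (64 * q : ℤ) < triNorm v ∧ triNorm v < 512 * ((q : ℤ) + 1) ∧
      ((0 < v 0 ∧ 0 < v 1) ∨ (v 0 < 0 ∧ v 1 < 0))) with hM
  have hSP : Disjoint S P := by
    rw [Finset.disjoint_left]; intro v hvS hvP
    simp only [hS, hP, Finset.mem_filter, mem_triBall_iff] at hvS hvP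
    push_cast at hvS hvP; omega
  have hSM : Disjoint S M := by
    rw [Finset.disjoint_left]; intro v hvS hvM
    simp only [hS, hM, Finset.mem_filter, mem_triBall_iff] at hvS hvM
    push_cast at hvS hvM; omega
  have hPM : Disjoint P M := by
    rw [Finset.disjoint_left]; intro v hvP hvM
    simp only [hP, hM, Finset.mem_filter] at hvP hvM
    omega
  have e8 : 64 * q / 8 = 8 * q := by omega
  have hq' : (1 : ℤ) ≤ q := by exact_mod_cast hq
  -- supports of the arm events
  have hIn0 : triRotIsoPow 0 '' sepConeSupport n₁ (64 * q) ⊆ ↑S ∪ ↑P := by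
    rintro w ⟨v, hv, rfl⟩
    rw [mem_sepConeSupport, e8] at hv
    simp only [triRotIsoPow_zero_apply, Set.mem_union, Finset.mem_coe, hS, hP, Finset.mem_filter, mem_triBall_iff]
    push_cast at hv ⊢; omega
  have hIn3 : triRotIsoPow 3 '' sepConeSupport n₁ (64 * q) ⊆ ↑S ∪ ↑P := by
    rintro w ⟨v, hv, rfl⟩
    rw [mem_sepConeSupport, e8] at hv
    obtain ⟨-, -, -, -, -, -, r30, r31, -⟩ := rot_apply_formula v
    have hn := triNorm_rot 3 v
    simp only [Set.mem_union, Finset.mem_coe, hS, hP, Finset.mem_filter, mem_triBall_iff, r30, r31, hn]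
    push_cast at hv ⊢; omega
  have hIn1 : triRotIsoPow 1 '' sepConeSupport n₁ (64 * q) ⊆ ↑S ∪ ↑M := by
    rintro w ⟨v, hv, rfl⟩
    rw [mem_sepConeSupport, e8] at hv
    obtain ⟨-, -, r10, r11, -⟩ := rot_apply_formula v
    have hn := triNorm_rot 1 v
    simp only [Set.mem_union, Finset.mem_coe, hS, hM, Finset.mem_filter, mem_triBall_iff, r10, r11, hn]
    push_cast at hv ⊢; omega
  have hIn4 : triRotIsoPow 4 '' sepConeSupport n₁ (64 * q) ⊆ ↑S ∪ ↑M := by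
    rintro w ⟨v, hv, rfl⟩
    rw [mem_sepConeSupport, e8] at hv
    obtain ⟨-, -, -, -, -, -, -, -, r40, r41, -⟩ := rot_apply_formula v
    have hn := triNorm_rot 4 v
    simp only [Set.mem_union, Finset.mem_coe, hS, hM, Finset.mem_filter, mem_triBall_iff, r40, r41, hn]
    push_cast at hv ⊢; omega
  -- supports of the extension events
  have hGF : ∀ v ∈ fourGlueExtFinset q, 0 < v 0 ∧ v 1 < 0 ∧ 0 < v 0 + v 1 := by
    intro v hv
    have h := fourGlueExtFinset_subset hq hv
    exact ⟨by omega, h.2.2.1, h.2.2.2⟩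
  have hG0 : triRotIsoPow 0 '' (↑(fourGlueExtFinset q) : Set (Site 2)) ⊆ ↑P := by
    rintro w ⟨v, hv, rfl⟩
    have h := fourGlueExtFinset_subset hq (Finset.mem_coe.1 hv)
    have hn : triNorm v = v 0 := triNorm_eq_apply_zero h.2.2.1.le h.2.2.2.le
    simp only [triRotIsoPow_zero_apply, Finset.mem_coe, hP, Finset.mem_filter, mem_triBall_iff, hn]
    push_cast; omega
  have hG3 : triRotIsoPow 3 '' (↑(fourGlueExtFinset q) : Set (Site 2)) ⊆ ↑P := by
    rintro w ⟨v, hv, rfl⟩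
    have h := fourGlueExtFinset_subset hq (Finset.mem_coe.1 hv)
    have hn : triNorm (triRotIsoPow 3 v) = v 0 := by
      rw [triNorm_rot]; exact triNorm_eq_apply_zero h.2.2.1.le h.2.2.2.le
    obtain ⟨-, -, -, -, -, -, r30, r31, -⟩ := rot_apply_formula v
    simp only [Finset.mem_coe, hP, Finset.mem_filter, mem_triBall_iff, hn, r30, r31]
    push_cast; omega
  have hG1 : triRotIsoPow 1 '' (↑(fourGlueExtFinset q) : Set (Site 2)) ⊆ ↑M := by
    rintro w ⟨v, hv, rfl⟩
    have h := fourGlueExtFinset_subset hq (Finset.mem_coe.1 hv)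
    have hn : triNorm (triRotIsoPow 1 v) = v 0 := by
      rw [triNorm_rot]; exact triNorm_eq_apply_zero h.2.2.1.le h.2.2.2.le
    obtain ⟨-, -, r10, r11, -⟩ := rot_apply_formula v
    simp only [Finset.mem_coe, hM, Finset.mem_filter, mem_triBall_iff, hn, r10, r11]
    push_cast; omega
  have hG4 : triRotIsoPow 4 '' (↑(fourGlueExtFinset q) : Set (Site 2)) ⊆ ↑M := by
    rintro w ⟨v, hv, rfl⟩
    have h := fourGlueExtFinset_subset hq (Finset.mem_coe.1 hv)
    have hn : triNorm (triRotIsoPow 4 v) = v 0 := by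
      rw [triNorm_rot]; exact triNorm_eq_apply_zero h.2.2.1.le h.2.2.2.le
    obtain ⟨-, -, -, -, -, -, -, -, r40, r41, -⟩ := rot_apply_formula v
    simp only [Finset.mem_coe, hM, Finset.mem_filter, mem_triBall_iff, hn, r40, r41]
    push_cast; omega
  -- locality
  have dA₁ := determinedBy_sepArmPair 0 true h4 h₁
  have dC₁ := determinedBy_sepArmPair 1 false h4 h₁
  have dG := determinedBy_fourGlueExt q
  set A₁ := sepArmPair 0 true n₁ (64 * q) with hA₁
  set C₁ := sepArmPair 1 false n₁ (64 * q) with hC₁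
  set G := fourGlueExt q with hGdef
  have fkg := triSitePercolation_locallyMonotone_fkg t hSP hSM hPM (Ap := A₁) (Am := C₁)
    (Bp := readFrame 0 true ⁻¹' G ∩ readFrame 3 true ⁻¹' G)
    (Bm := readFrame 1 false ⁻¹' G ∩ readFrame 4 false ⁻¹' G)
    (isUpperSet_sepArmPair_true 0 n₁ (64 * q)) (isLowerSet_sepArmPair_false 1 n₁ (64 * q))
    ((IsUpperSet.preimage_readFrame_true 0 (isUpperSet_fourGlueExt q)).inter
      (IsUpperSet.preimage_readFrame_true 3 (isUpperSet_fourGlueExt q)))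
    ((IsUpperSet.preimage_readFrame_false 1 (isUpperSet_fourGlueExt q)).inter
      (IsUpperSet.preimage_readFrame_false 4 (isUpperSet_fourGlueExt q)))
    (dA₁.mono (union_subset hIn0 hIn3)) (dC₁.mono (union_subset hIn1 hIn4))
    (((determinedBy_preimage_readFrame 0 true dG).mono hG0).inter
      ((determinedBy_preimage_readFrame 3 true dG).mono hG3))
    (((determinedBy_preimage_readFrame 1 false dG).mono hG1).inter
      ((determinedBy_preimage_readFrame 4 false dG).mono hG4))
  have hBp : (triSitePercolation t).real (readFrame 0 true ⁻¹' G ∩ readFrame 3 true ⁻¹' G) =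
      (triSitePercolation t).real G * (triSitePercolation t).real G := by
    rw [real_inter_preimage_readFrame_at t (by norm_num) (by norm_num) (by norm_num) true dG hGF]; rfl
  have hBm : (triSitePercolation t).real (readFrame 1 false ⁻¹' G ∩ readFrame 4 false ⁻¹' G) =
      (triSitePercolation (σ t)).real G * (triSitePercolation (σ t)).real G := by
    rw [real_inter_preimage_readFrame_at t (by norm_num) (by norm_num) (by norm_num) false dG hGF]; rfl
  have hsub : A₁ ∩ C₁ ∩
      (readFrame 0 true ⁻¹' G ∩ readFrame 3 true ⁻¹' G ∩ (readFrame 1 false ⁻¹' G ∩ readFrame 4 false ⁻¹' G)) ⊆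
      landedAltFourArm n₁ (512 * (q + 1) - 1) := by
    rintro ω ⟨⟨hA1, hC1⟩, hBp', hBm'⟩
    exact sepFourArm_glueExt_subset_landedAlt hq h4 h₁ ⟨⟨hA1, hC1⟩, hBp', hBm'⟩
  calc (triSitePercolation t).real (sepFourArm n₁ (64 * q)) *
        ((triSitePercolation t).real G ^ 2 * (triSitePercolation (σ t)).real G ^ 2)
      = (triSitePercolation t).real (A₁ ∩ C₁) *
          ((triSitePercolation t).real (readFrame 0 true ⁻¹' G ∩ readFrame 3 true ⁻¹' G) *
            (triSitePercolation t).real (readFrame 1 false ⁻¹' G ∩ readFrame 4 false ⁻¹' G)) := by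
        rw [hBp, hBm]; simp only [sepFourArm, hA₁, hC₁]; ring
    _ ≤ _ := fkg
    _ ≤ (triSitePercolation t).real (landedAltFourArm n₁ (512 * (q + 1) - 1)) :=
        measureReal_mono hsub (measure_ne_top _ _)

/-- **The gluing inequality, landing in `π̂^alt`**: `P_t(sep₄(n₁, 64q)) · P_t(sep₄(512(q+1), n₃)) ·
P_t(G)² · P_{1-t}(G)² ≤ π̂^alt_t(n₁, n₃)` (`sepFour_mul_sepFour_mul_glue_le_landed_at` with
`landedAltFourArm ⊆ altFourArm`). [cite: Nolin2008, §4.3 Prop. 12 and Lemma 13 (arXiv 0711.4948: Prop. 11, Lemma 12)] -/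
theorem sepFour_mul_sepFour_mul_glue_le_alt_at (t : unitInterval) {q n₁ n₃ : ℕ} (hq : 1 ≤ q) (h4 : 4 ≤ n₁)
    (h₁ : n₁ ≤ 64 * q) (h₃ : 512 * (q + 1) ≤ n₃) :
    (triSitePercolation t).real (sepFourArm n₁ (64 * q)) *
        (triSitePercolation t).real (sepFourArm (512 * (q + 1)) n₃) *
        ((triSitePercolation t).real (fourGlue q) ^ 2 * (triSitePercolation (σ t)).real (fourGlue q) ^ 2) ≤
      altFourArmProbAt t n₁ n₃ :=
  (sepFour_mul_sepFour_mul_glue_le_landed_at t hq h4 h₁ h₃).trans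
    (real_landedAltFourArm_le_altFourArmProbAt t (by omega) (h₁.trans (le_trans (by omega) h₃)))

/-- **The extension inequality, landing in `π̂^alt`**:
`P_t(sep₄(n₁, 64q)) · P_t(G_ext)² · P_{1-t}(G_ext)² ≤ π̂^alt_t(n₁, 512(q+1) - 1)`. [cite: Nolin2008, §4.3 Prop. 12 and Lemma 13 (arXiv 0711.4948: Prop. 11, Lemma 12)] -/
theorem sepFour_mul_glueExt_le_alt_at (t : unitInterval) {q n₁ : ℕ} (hq : 1 ≤ q) (h4 : 4 ≤ n₁) (h₁ : n₁ ≤ 64 * q) :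
    (triSitePercolation t).real (sepFourArm n₁ (64 * q)) *
        ((triSitePercolation t).real (fourGlueExt q) ^ 2 * (triSitePercolation (σ t)).real (fourGlueExt q) ^ 2) ≤
      altFourArmProbAt t n₁ (512 * (q + 1) - 1) :=
  (sepFour_mul_glueExt_le_landed_at t hq h4 h₁).trans
    (real_landedAltFourArm_le_altFourArmProbAt t (by omega) (by omega))

/-! ### Cor. 6.2 for `π̂^alt` from alternating separation -/

set_option maxHeartbeats 1600000 in
set_option maxRecDepth 4096 in
/-- **Quasi-multiplicativity of Werner's ALTERNATING `π̂` below `L(p)` from alternating four-arm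
separation** (Werner 2009, Lecture 6, Cor. 6.2: "for all `16 r₁ < 4 r₂ < r₃ ≤ L(p)`,
`c × π̂_p(r₁, r₂) × π̂_p(4 r₂, r₃) ≤ π̂_p(r₁, r₃)`", from Prop. 6.1; Nolin 2008, Prop. 17 with
Thm. 11 and Prop. 12 for `σ = BWBW` [arXiv 0711.4948: Prop. 16, Thm. 10, Prop. 11]). IF the
well-separated alternating four-arm event is comparable to the alternating event uniformly below
Werner's length — `c · π̂^alt_t(n, N) ≤ P_t(sepFourArm n N)` for `n₀ ≤ n`, `2n ≤ N`, `N ≤ L(t, ε)`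
if `t > 1/2`, `t ∈ [1/2, 1/2 + δ)` — THEN `c' · π̂^alt_t(r, R) · π̂^alt_t(4R, S) ≤ π̂^alt_t(r, S)`
for `r₁ ≤ r`, `16 r < 4 R < S`, `S ≤ L(t, ε)` if `t > 1/2` (the `∀∃` shape of
`Werner2009_fourArm_quasiMult`, for `altFourArmProbAt`). Proof verbatim that of
`Werner2009_fourArm_quasiMult_of_separation`, with the alternating gluing inequalities
`sepFour_mul_sepFour_mul_glue_le_alt_at`, `sepFour_mul_glueExt_le_alt_at` and the monotonicity of
`π̂^alt` in the radii (`altFourArmProbAt_anti`, `altFourArmProbAt_mono_left`). [cite: WernerPCMI2009, Lecture 6, Cor. 6.2 (with Prop. 6.1)] [cite: Nolin2008, Prop. 17 with Thm. 11 and Prop. 12 (arXiv 0711.4948: Prop. 16, Thm. 10, Prop. 11)] -/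
theorem altFourArm_quasiMult_of_altSeparation
    (hsepA : ∃ ε₁ > (0 : ℝ), ∀ ⦃ε : ℝ⦄, 0 < ε → ε < ε₁ →
      ∃ n₀ : ℕ, ∃ δ > (0 : ℝ), ∃ c > (0 : ℝ),
        ∀ t : unitInterval, 1 / 2 ≤ (t : ℝ) → (t : ℝ) < 1 / 2 + δ →
          ∀ n N : ℕ, n₀ ≤ n → 2 * n ≤ N → (1 / 2 < (t : ℝ) → N ≤ charLengthW ε t) →
            c * altFourArmProbAt t n N ≤ (triSitePercolation t).real (sepFourArm n N)) :
    ∃ ε₁ > (0 : ℝ), ∀ ⦃ε : ℝ⦄, 0 < ε → ε < ε₁ →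
      ∃ r₁ : ℕ, ∃ δ > (0 : ℝ), ∃ c > (0 : ℝ),
        ∀ t : unitInterval, 1 / 2 ≤ (t : ℝ) → (t : ℝ) < 1 / 2 + δ →
          ∀ r R S : ℕ, r₁ ≤ r → 16 * r < 4 * R → 4 * R < S →
            (1 / 2 < (t : ℝ) → S ≤ charLengthW ε t) →
              c * (altFourArmProbAt t r R * altFourArmProbAt t (4 * R) S) ≤ altFourArmProbAt t r S := by
  obtain ⟨ε₁, hε₁, H⟩ := hsepA
  refine ⟨ε₁, hε₁, fun ε hε hεε₁ => ?_⟩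
  obtain ⟨n₀, δs, hδs, cs, hcs, Hs⟩ := H hε hεε₁
  -- RSW below Werner's length, and at `1/2`
  obtain ⟨ε', hε', hε'2, hLen⟩ := charLengthW_le_charLength_of_gt hε
  obtain ⟨η, hη, -, hRSW⟩ := exists_pow_le_triLRCrossingProb_below hε' hε'2
  obtain ⟨c₀, hc₀, h0⟩ := tri_rsw_half_holds 98 (by norm_num)
  set θ : ℝ := min (η ^ 97) c₀ with hθ
  have hθ0 : 0 < θ := lt_min (pow_pos hη _) hc₀
  set g : ℝ := θ ^ 73 with hg
  have hg0 : 0 < g := pow_pos hθ0 _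
  set cE : ℝ := cs * (g ^ 2 * g ^ 2) with hcE
  set cQ : ℝ := cs * cs * (g ^ 2 * g ^ 2) with hcQ
  have hcE0 : 0 < cE := by positivity
  have hcQ0 : 0 < cQ := by positivity
  refine ⟨max n₀ 32, min δs (1 / 4), lt_min hδs (by norm_num), min cQ (cE * cE),
    lt_min hcQ0 (by positivity), fun t ht1 ht2 r R S hr hR hS hSL => ?_⟩
  have htδ : (t : ℝ) < 1 / 2 + δs := lt_of_lt_of_le ht2 (by linarith [min_le_left δs (1 / 4)])
  have ht34 : (t : ℝ) < 3 / 4 := by linarith [min_le_right δs (1 / 4)]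
  have hrn₀ : n₀ ≤ r := le_trans (le_max_left _ _) hr
  have hr32 : 32 ≤ r := le_trans (le_max_right _ _) hr
  -- the scale `q = ⌊R / 64⌋`
  set q := R / 64 with hq
  have hdm := Nat.div_add_mod R 64
  have hml := Nat.mod_lt R (by norm_num : 64 > 0)
  have hqR : 64 * q ≤ R := by omega
  have hRq : R < 64 * (q + 1) := by omega
  have hq2 : 2 ≤ q := by omega
  have hq1 : 1 ≤ q := by omega
  have h2r : 2 * r ≤ 64 * q := by omega
  have h4r : 4 ≤ r := by omega
  have nn : ∀ a b : ℕ, 0 ≤ altFourArmProbAt t a b := fun a b => altFourArmProbAt_nonneg t a b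
  have l1 : ∀ a b : ℕ, altFourArmProbAt t a b ≤ 1 := fun a b => altFourArmProbAt_le_one t a b
  have anti : ∀ {a b b' : ℕ}, a ≤ b → b ≤ b' → altFourArmProbAt t a b' ≤ altFourArmProbAt t a b :=
    fun hab hbb => altFourArmProbAt_anti t _ hab hbb
  have monoL : ∀ {a a' b : ℕ}, a ≤ a' → a' ≤ b → altFourArmProbAt t a b ≤ altFourArmProbAt t a' b :=
    fun haa hab => altFourArmProbAt_mono_left t haa hab
  -- separation below `S`
  have sepAt : ∀ n N : ℕ, n₀ ≤ n → 2 * n ≤ N → N ≤ S →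
      cs * altFourArmProbAt t n N ≤ (triSitePercolation t).real (sepFourArm n N) :=
    fun n N hn h2 hNS => Hs t ht1 htδ n N hn h2 (fun hgt => hNS.trans (hSL hgt))
  -- RSW below `S`, at `t` and at `1 - t`
  have key : ∀ Q : ℕ, 64 * Q < S → ∀ p : unitInterval, (p = t ∨ p = σ t) →
      ∀ w h : ℕ, 1 ≤ h → h ≤ 64 * Q → w ≤ 98 * h → θ ≤ triLRCrossingProb p w h := by
    intro Q hQ p hp w h h1 hh hw
    have hanti : triLRCrossingProb p (98 * h) h ≤ triLRCrossingProb p w h := triLRCrossingProb_anti_width p hw h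
    refine le_trans ?_ hanti
    rcases eq_or_lt_of_le ht1 with heq | hgt
    · -- `t = 1/2`
      have ht : t = half := Subtype.ext (by rw [coe_half]; exact heq.symm)
      have hp' : p = half := by
        rcases hp with rfl | rfl
        · exact ht
        · rw [ht, symm_half]
      have hfl : ⌊(98 : ℝ) * h⌋₊ = 98 * h := by
        have : (98 : ℝ) * h = ((98 * h : ℕ) : ℝ) := by push_cast; ring
        rw [this, Nat.floor_natCast]
      have := (h0 h (by rw [hfl]; omega)).1
      rw [hfl] at this
      rw [hp']
      exact (min_le_right _ _).trans this
    · -- `t > 1/2`: below Nolin's length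
      have hhL : h < charLength ε' t :=
        lt_of_lt_of_le (by omega : h < S) ((hSL hgt).trans (hLen t hgt ht34))
      have hpmin : min t (σ t) ≤ p := by
        rcases hp with rfl | rfl
        · exact min_le_left _ _
        · exact min_le_right _ _
      have := hRSW t p hpmin h h1 hhL 97 (98 * h) (by norm_num) (by omega)
      exact (min_le_left _ _).trans this
  have h64S : 64 * q < S := by omega
  have h192S : 64 * (3 * q) < S := by omega
  have hG : ∀ Q : ℕ, 1 ≤ Q → 64 * Q < S → ∀ p : unitInterval, (p = t ∨ p = σ t) →
      g ≤ (triSitePercolation p).real (fourGlue Q) ∧ g ≤ (triSitePercolation p).real (fourGlueExt Q) :=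
    fun Q hQ1 hQS p hp => le_real_fourGlue_of_rsw p hQ1 hθ0.le (key Q hQS p hp)
  have hmin₁ : min cQ (cE * cE) ≤ cQ := min_le_left _ _
  have hmin₂ : min cQ (cE * cE) ≤ cE * cE := min_le_right _ _
  by_cases hcase : 2 * (512 * (q + 1)) ≤ S
  · -- well-spaced scales: the gluing inequality
    have glue := sepFour_mul_sepFour_mul_glue_le_alt_at t (q := q) (n₁ := r) (n₃ := S) hq1 h4r (by omega) (by omega)
    have s1 : cs * altFourArmProbAt t r R ≤ (triSitePercolation t).real (sepFourArm r (64 * q)) :=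
      le_trans (mul_le_mul_of_nonneg_left (anti (by omega) hqR) hcs.le) (sepAt r (64 * q) hrn₀ h2r (by omega))
    have s2 : cs * altFourArmProbAt t (4 * R) S ≤ (triSitePercolation t).real (sepFourArm (512 * (q + 1)) S) :=
      le_trans (mul_le_mul_of_nonneg_left (monoL (by omega) (by omega)) hcs.le)
        (sepAt (512 * (q + 1)) S (by omega) hcase le_rfl)
    obtain ⟨gt, -⟩ := hG q hq1 h64S t (Or.inl rfl)
    obtain ⟨gs, -⟩ := hG q hq1 h64S (σ t) (Or.inr rfl)
    have hGG : g ^ 2 * g ^ 2 ≤ (triSitePercolation t).real (fourGlue q) ^ 2 *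
        (triSitePercolation (σ t)).real (fourGlue q) ^ 2 :=
      mul_le_mul (pow_le_pow_left₀ hg0.le gt 2) (pow_le_pow_left₀ hg0.le gs 2) (pow_nonneg hg0.le 2)
        (pow_nonneg measureReal_nonneg 2)
    calc min cQ (cE * cE) * (altFourArmProbAt t r R * altFourArmProbAt t (4 * R) S)
        ≤ cQ * (altFourArmProbAt t r R * altFourArmProbAt t (4 * R) S) :=
          mul_le_mul_of_nonneg_right hmin₁ (mul_nonneg (nn _ _) (nn _ _))
      _ = (cs * altFourArmProbAt t r R) * (cs * altFourArmProbAt t (4 * R) S) * (g ^ 2 * g ^ 2) := by rw [hcQ]; ring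
      _ ≤ (triSitePercolation t).real (sepFourArm r (64 * q)) *
            (triSitePercolation t).real (sepFourArm (512 * (q + 1)) S) *
            ((triSitePercolation t).real (fourGlue q) ^ 2 * (triSitePercolation (σ t)).real (fourGlue q) ^ 2) :=
          mul_le_mul (mul_le_mul s1 s2 (mul_nonneg hcs.le (nn _ _)) measureReal_nonneg) hGG
            (mul_nonneg (pow_nonneg hg0.le 2) (pow_nonneg hg0.le 2))
            (mul_nonneg measureReal_nonneg measureReal_nonneg)
      _ ≤ altFourArmProbAt t r S := glue
  · -- bounded ratio: two extensions, at the scales `q` and `3q`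
    have hcase' : S < 2 * (512 * (q + 1)) := Nat.lt_of_not_le hcase
    have h3q1 : 1 ≤ 3 * q := by omega
    obtain ⟨-, gt₁⟩ := hG q hq1 h64S t (Or.inl rfl)
    obtain ⟨-, gs₁⟩ := hG q hq1 h64S (σ t) (Or.inr rfl)
    obtain ⟨-, gt₃⟩ := hG (3 * q) h3q1 h192S t (Or.inl rfl)
    obtain ⟨-, gs₃⟩ := hG (3 * q) h3q1 h192S (σ t) (Or.inr rfl)
    have hGG₁ : g ^ 2 * g ^ 2 ≤ (triSitePercolation t).real (fourGlueExt q) ^ 2 *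
        (triSitePercolation (σ t)).real (fourGlueExt q) ^ 2 :=
      mul_le_mul (pow_le_pow_left₀ hg0.le gt₁ 2) (pow_le_pow_left₀ hg0.le gs₁ 2) (pow_nonneg hg0.le 2)
        (pow_nonneg measureReal_nonneg 2)
    have hGG₃ : g ^ 2 * g ^ 2 ≤ (triSitePercolation t).real (fourGlueExt (3 * q)) ^ 2 *
        (triSitePercolation (σ t)).real (fourGlueExt (3 * q)) ^ 2 :=
      mul_le_mul (pow_le_pow_left₀ hg0.le gt₃ 2) (pow_le_pow_left₀ hg0.le gs₃ 2) (pow_nonneg hg0.le 2)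
        (pow_nonneg measureReal_nonneg 2)
    have hGGn₁ : 0 ≤ (triSitePercolation t).real (fourGlueExt q) ^ 2 *
        (triSitePercolation (σ t)).real (fourGlueExt q) ^ 2 :=
      mul_nonneg (pow_nonneg measureReal_nonneg 2) (pow_nonneg measureReal_nonneg 2)
    have hGGn₃ : 0 ≤ (triSitePercolation t).real (fourGlueExt (3 * q)) ^ 2 *
        (triSitePercolation (σ t)).real (fourGlueExt (3 * q)) ^ 2 :=
      mul_nonneg (pow_nonneg measureReal_nonneg 2) (pow_nonneg measureReal_nonneg 2)
    have e1 := sepFour_mul_glueExt_le_alt_at t (q := q) (n₁ := r) hq1 h4r (by omega)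
    have e2 := sepFour_mul_glueExt_le_alt_at t (q := 3 * q) (n₁ := r) h3q1 h4r (by omega)
    -- first extension: `cE π̂(r, R) ≤ π̂(r, 192q)`
    have x1 : cE * altFourArmProbAt t r R ≤ altFourArmProbAt t r (64 * (3 * q)) := by
      have s1 : cs * altFourArmProbAt t r R ≤ (triSitePercolation t).real (sepFourArm r (64 * q)) :=
        le_trans (mul_le_mul_of_nonneg_left (anti (by omega) hqR) hcs.le) (sepAt r (64 * q) hrn₀ h2r (by omega))
      calc cE * altFourArmProbAt t r R = cs * altFourArmProbAt t r R * (g ^ 2 * g ^ 2) := by rw [hcE]; ring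
        _ ≤ (triSitePercolation t).real (sepFourArm r (64 * q)) *
              ((triSitePercolation t).real (fourGlueExt q) ^ 2 * (triSitePercolation (σ t)).real (fourGlueExt q) ^ 2) :=
            mul_le_mul s1 hGG₁ (mul_nonneg (pow_nonneg hg0.le 2) (pow_nonneg hg0.le 2)) measureReal_nonneg
        _ ≤ altFourArmProbAt t r (512 * (q + 1) - 1) := e1
        _ ≤ altFourArmProbAt t r (64 * (3 * q)) := anti (by omega) (by omega)
    -- second extension: `cE π̂(r, 192q) ≤ π̂(r, S)`
    have x2 : cE * altFourArmProbAt t r (64 * (3 * q)) ≤ altFourArmProbAt t r S := by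
      have s3 : cs * altFourArmProbAt t r (64 * (3 * q)) ≤ (triSitePercolation t).real (sepFourArm r (64 * (3 * q))) :=
        sepAt r (64 * (3 * q)) hrn₀ (by omega) (by omega)
      calc cE * altFourArmProbAt t r (64 * (3 * q))
          = cs * altFourArmProbAt t r (64 * (3 * q)) * (g ^ 2 * g ^ 2) := by rw [hcE]; ring
        _ ≤ (triSitePercolation t).real (sepFourArm r (64 * (3 * q))) *
              ((triSitePercolation t).real (fourGlueExt (3 * q)) ^ 2 *
                (triSitePercolation (σ t)).real (fourGlueExt (3 * q)) ^ 2) :=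
            mul_le_mul s3 hGG₃ (mul_nonneg (pow_nonneg hg0.le 2) (pow_nonneg hg0.le 2)) measureReal_nonneg
        _ ≤ altFourArmProbAt t r (512 * (3 * q + 1) - 1) := e2
        _ ≤ altFourArmProbAt t r S := anti (by omega) (by omega)
    calc min cQ (cE * cE) * (altFourArmProbAt t r R * altFourArmProbAt t (4 * R) S)
        ≤ (cE * cE) * (altFourArmProbAt t r R * 1) :=
          mul_le_mul hmin₂ (mul_le_mul_of_nonneg_left (l1 _ _) (nn _ _)) (mul_nonneg (nn _ _) (nn _ _))
            (mul_nonneg hcE0.le hcE0.le)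
      _ = cE * (cE * altFourArmProbAt t r R) := by ring
      _ ≤ cE * altFourArmProbAt t r (64 * (3 * q)) := mul_le_mul_of_nonneg_left x1 hcE0.le
      _ ≤ altFourArmProbAt t r S := x2

end Literature.Probability.Percolation
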